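import Literature.NumberTheory.ComplexMultiplication.CMOrderMaximalOrderGeneratorsCount
import Literature.NumberTheory.ComplexMultiplication.CMOrderCohenMacaulayTypeGenerators
import Literature.NumberTheory.ComplexMultiplication.CMOrderCohenMacaulayTypeTwoWeakClasses
import Literature.NumberTheory.ComplexMultiplication.CMOrderBassCharacterization
import HarnessLib

/-!
# Quadratic orders have Cohen–Macaulay type `1` (they are Bass): MARSEGLIA 2024's invariants in degree `2`, and the
# validation `ℤ[√-3]`: `type = 1`, `dim_{S/𝔭} (𝔭:𝔭)/𝔭 = gens_S((𝔭:𝔭)) = dim_{S/𝔭} 𝒪_K/𝔭𝒪_K = gens_S(𝒪_K) = 2` at the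
# singular primes

Family `hodge`, lane `lit-hodgefound` (Track 2 foundations library; seat p15, row g28-#9 — the VALIDATION row of the
Marseglia series g27-#1 … g28-#8), topic `Literature/NumberTheory/ComplexMultiplication`, namespaces
`Literature.NumberTheory.ComplexMultiplication.CMTypeLattice` (§1: an order `S = endOrder (M_μ)` of a QUADRATIC field,
`μ : Basis (Fin 2) ℚ K`) and `…CMTypeLattice.EisensteinTwo` (§2: the tree's `S = ℤ[√-3] = ℤ[2ζ₃] ⊂ K₃ = ℚ(ζ₃)`,
`basis = (1, 2ζ₃)`, singular prime `primeTwo = 𝔭₂ = (2, 1+√-3) = 𝔣_S`).  Vocabulary of the series: local type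
`type_𝔭(S) = finrank (S ⧸ 𝔭) (↥↑T ⧸ 𝔭 • ⊤)` (`↑T = Sᵗ`), global type `⨆ 𝔭, type_𝔭(S)`, `(𝔭:𝔭)/𝔭 = ↥↑(↑𝔭/↑𝔭) ⧸ 𝔭 • ⊤`,
`gens_S(I) = Submodule.spanFinrank ↑I`, maximal order `M` (`↑M = 𝒪_K`), `𝒪_K/𝔭𝒪_K = ↥↑M ⧸ 𝔭 • ⊤`, weak classes
`W̄(S)` as the `Quot` of `CMOrderWeakClassesCount`.  THEOREMS ONLY (net Literature debt `0`).

## Sources, VERBATIM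

S. Marseglia, *Cohen-Macaulay type of orders, generators and ideal classes*, J. Algebra 658 (2024) 247–276
[Marseglia2024CMType] (arXiv:2206.03758), §1 p0003: "We invite the reader to compare it to the case when `S` is a
non-maximal Bass order, that is, such that all the overorders are Gorenstein. See Proposition 4.6."; §3 Prop. 3.4
(p0009): "`S` is Gorenstein ⟺ `type_𝔭(S) = 1` for every prime `𝔭` ⟺ `Sᵗ` is invertible"; §4 Prop. 4.5, Cor. 4.4,
Thm. 4.7 eq. (4.3), §3 Cor. 3.6, §6 Cor. 6.5 (chunks p0009–p0015, quoted in the files they are proved in).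
S. Marseglia, *Computing the ideal class monoid of an order*, J. Lond. Math. Soc. 101 (2020) [Marseglia2019], §2 Cor. 2.11
and the sentence «every order in a quadratic number field is a Bass order» (p. 5) — in the tree as
`CMOrderGorenstein.exists_traceDual_one_eq_spanSingleton_inv` (`Sᵗ = γ⁻¹S` is invertible for `[K:ℚ] = 2`).
P. Stevenhagen, *The arithmetic of number rings* [Stevenhagen2008NumberRings], Examples 4.2 / §6–§7 (`ℤ[√-3]`,
`𝔭 = (2, 1+√-3)`, `𝔣_R = 2𝒪 = 𝔭`), pp. 217, 224, 231 — the tree's `EisensteinTwo` files.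

## What is formalised

* §1 (quadratic `S`): **`type_𝔭(S) = 1` at every prime and `type(S) = 1`** (PROP. 3.4 with `Sᵗ` invertible:
  `finrank_traceDual_quotient_eq_one_of_quadratic`, `iSup_finrank_traceDual_quotient_eq_one_of_quadratic`); MAIN
  THEOREM 3 (2) degenerates to `#W̄(S) = 2⁰ = 1` (`natCard_quot_stratum_weak_eq_one_of_quadratic`); for `S ≠ 𝒪_K` and a
  singular (non-invertible) prime `𝔭`: COR. 3.6 / eq. (4.3) give `dim_{S/𝔭} (𝔭:𝔭)/𝔭 = gens_S((𝔭:𝔭)) = 2`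
  (`finrank_div_self_quotient_eq_two_of_quadratic`, `spanFinrank_coe_div_self_eq_two_of_quadratic`), PROP. 4.5 gives
  `dim_{S/𝔭} 𝒪_K/𝔭𝒪_K = 2` (`finrank_quotient_smul_top_eq_two_of_quadratic`, through the over-order `S + 𝔭𝒪_K`, again
  quadratic), COR. 4.4 gives `gens_S(𝒪_K) = 2` (`spanFinrank_coe_eq_two_of_quadratic`).
* §2 (`S = ℤ[√-3]`, `𝔭₂`; `Sᵗ` described through the trace pairing, `coe_eq_traceDual_one_of_forall_mem_iff`): `type_{𝔭₂} = 1`, `type = 1`, `dim_{𝔽₂} (𝔭₂:𝔭₂)/𝔭₂ = 2`, `gens((𝔭₂:𝔭₂)) = 2`,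
  `dim_{𝔽₂} 𝒪_K/𝔭₂𝒪_K = 2`, `gens_{ℤ[√-3]}(𝒪_K) = 2`.
-/

noncomputable section

open scoped nonZeroDivisors NumberField
open NumberField Module FractionalIdeal
open Submodule (traceDual)

namespace Literature.NumberTheory.ComplexMultiplication

namespace CMTypeLattice

section Quadratic

variable {K : Type} [Field K] [NumberField K]
variable (μ : Basis (Fin 2) ℚ K) [IsFractionRing (endOrder (Algebra.leftMulMatrix μ)) K]

/-! ## §1 Quadratic orders: `type ≡ 1`; at singular primes `dim (𝔭:𝔭)/𝔭 = gens((𝔭:𝔭)) = dim 𝒪_K/𝔭𝒪_K = gens(𝒪_K) = 2` -/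

omit [IsFractionRing (endOrder (Algebra.leftMulMatrix μ)) K] in
/-- Plumbing: the trace dual `Sᵗ` described through the trace pairing — if `T = {x : Tr(xy) ∈ ℤ for all y ∈ S}` then
`↑T = Sᵗ` in the series' form. [cite: Marseglia2024CMType, §2.3 («the trace dual ideal `Iᵗ = {a ∈ K : Tr(aI) ⊆ Z}`»), p. 5] -/
theorem coe_eq_traceDual_one_of_forall_mem_iff {T : FractionalIdeal (endOrder (Algebra.leftMulMatrix μ))⁰ K}
    (h : ∀ x : K, x ∈ T ↔ ∀ y ∈ endOrder (Algebra.leftMulMatrix μ), ∃ n : ℤ, Algebra.trace ℚ K (x * y) = n) :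
    (T : Submodule (endOrder (Algebra.leftMulMatrix μ)) K) =
      traceDual ℤ ℚ ((1 : FractionalIdeal (endOrder (Algebra.leftMulMatrix μ))⁰ K) :
        Submodule (endOrder (Algebra.leftMulMatrix μ)) K) := by
  refine (coe_eq_traceDual_iff μ).2 (Submodule.ext fun x ↦ ?_)
  rw [Submodule.restrictScalars_mem, mem_coe, h x, mem_traceDual_iff_forall_exists_int]
  refine forall_congr' fun a ↦ ?_
  have ha : a ∈ ((1 : FractionalIdeal (endOrder (Algebra.leftMulMatrix μ))⁰ K) :
      Submodule (endOrder (Algebra.leftMulMatrix μ)) K).restrictScalars ℤ ↔ a ∈ endOrder (Algebra.leftMulMatrix μ) := by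
    rw [Submodule.restrictScalars_mem, mem_coe, mem_one_iff]
    exact ⟨fun ⟨y, hy⟩ ↦ hy ▸ y.2, fun ha ↦ ⟨⟨a, ha⟩, rfl⟩⟩
  rw [ha]

/-- **Every order of a quadratic field has `type_𝔭(S) = 1` at every prime** («every order in a quadratic number field is
a Bass order»: `Sᵗ = γ⁻¹S` is invertible, and PROP. 3.4 (3)⟹(2)). [cite: Marseglia2024CMType, §3 Prop. 3.4, p. 9; §1
(«compare it to the case when `S` is a non-maximal Bass order»), p. 3] [cite: Marseglia2019, §2 Cor. 2.11, p. 5] -/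
theorem finrank_traceDual_quotient_eq_one_of_quadratic {T : FractionalIdeal (endOrder (Algebra.leftMulMatrix μ))⁰ K}
    (hT : (T : Submodule (endOrder (Algebra.leftMulMatrix μ)) K) =
      traceDual ℤ ℚ ((1 : FractionalIdeal (endOrder (Algebra.leftMulMatrix μ))⁰ K) :
        Submodule (endOrder (Algebra.leftMulMatrix μ)) K))
    {𝔭 : Ideal (endOrder (Algebra.leftMulMatrix μ))} [h𝔭 : 𝔭.IsPrime] (h0 : 𝔭 ≠ ⊥) :
    Module.finrank (endOrder (Algebra.leftMulMatrix μ) ⧸ 𝔭)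
      ((T : Submodule (endOrder (Algebra.leftMulMatrix μ)) K) ⧸
        (𝔭 • ⊤ : Submodule (endOrder (Algebra.leftMulMatrix μ))
          (T : Submodule (endOrder (Algebra.leftMulMatrix μ)) K))) = 1 := by
  obtain ⟨γ, -, -, hunit⟩ := exists_traceDual_one_eq_spanSingleton_inv μ hT
  haveI := isMaximal_of_isPrime_endOrder (Algebra.leftMulMatrix μ) h𝔭 h0
  exact (forall_finrank_traceDual_quotient_eq_one_iff_isUnit μ hT).2 hunit ⟨𝔭, ‹_›⟩

/-- **The global type of a quadratic order is `1`.** [cite: Marseglia2024CMType, §3 Def. 3.2 (ii), Prop. 3.4, p. 9]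
[cite: Marseglia2019, §2 Cor. 2.11, p. 5] -/
theorem iSup_finrank_traceDual_quotient_eq_one_of_quadratic {T : FractionalIdeal (endOrder (Algebra.leftMulMatrix μ))⁰ K}
    (hT : (T : Submodule (endOrder (Algebra.leftMulMatrix μ)) K) =
      traceDual ℤ ℚ ((1 : FractionalIdeal (endOrder (Algebra.leftMulMatrix μ))⁰ K) :
        Submodule (endOrder (Algebra.leftMulMatrix μ)) K)) :
    ⨆ 𝔭 : MaximalSpectrum (endOrder (Algebra.leftMulMatrix μ)),
        Module.finrank (endOrder (Algebra.leftMulMatrix μ) ⧸ 𝔭.asIdeal)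
          ((T : Submodule (endOrder (Algebra.leftMulMatrix μ)) K) ⧸
            (𝔭.asIdeal • ⊤ : Submodule (endOrder (Algebra.leftMulMatrix μ))
              (T : Submodule (endOrder (Algebra.leftMulMatrix μ)) K))) = 1 :=
  (iSup_finrank_traceDual_quotient_eq_one_iff μ hT).2 fun 𝔭 ↦
    finrank_traceDual_quotient_eq_one_of_quadratic μ hT (asIdeal_ne_bot μ 𝔭)

/-- **MAIN THEOREM 3 (2) in degree `2`: no prime has type `2`, so `#W̄(S) = 2⁰ = 1`** — one weak equivalence class with
multiplicator ring `S` (consistent with COR. 5.3 «`T` is Gorenstein iff `#W̄_T(S) = 1`»,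
`CMOrderGorensteinWeakClassesCount`). [cite: Marseglia2024CMType, §6 Cor. 6.5, p. 15; §5 Cor. 5.3, p. 13] -/
theorem natCard_quot_stratum_weak_eq_one_of_quadratic {T : FractionalIdeal (endOrder (Algebra.leftMulMatrix μ))⁰ K}
    (hT : (T : Submodule (endOrder (Algebra.leftMulMatrix μ)) K) =
      traceDual ℤ ℚ ((1 : FractionalIdeal (endOrder (Algebra.leftMulMatrix μ))⁰ K) :
        Submodule (endOrder (Algebra.leftMulMatrix μ)) K)) :
    Nat.card (Quot fun I N : {I : FractionalIdeal (endOrder (Algebra.leftMulMatrix μ))⁰ K //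
        I ≠ 0 ∧ ((I / I : FractionalIdeal (endOrder (Algebra.leftMulMatrix μ))⁰ K) : Set K) =
          (endOrder (Algebra.leftMulMatrix μ) : Set K)} =>
      (1 : K) ∈ (I : FractionalIdeal (endOrder (Algebra.leftMulMatrix μ))⁰ K) / N * (N / I)) = 1 := by
  rw [natCard_quot_stratum_weak_eq_two_pow μ hT fun 𝔭 ↦
    (finrank_traceDual_quotient_eq_one_of_quadratic μ hT (asIdeal_ne_bot μ 𝔭)).trans_le one_le_two]
  haveI : IsEmpty {𝔭 : MaximalSpectrum (endOrder (Algebra.leftMulMatrix μ)) //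
      Module.finrank (endOrder (Algebra.leftMulMatrix μ) ⧸ 𝔭.asIdeal)
        ((T : Submodule (endOrder (Algebra.leftMulMatrix μ)) K) ⧸
          (𝔭.asIdeal • ⊤ : Submodule (endOrder (Algebra.leftMulMatrix μ))
            (T : Submodule (endOrder (Algebra.leftMulMatrix μ)) K))) = 2} :=
    ⟨fun 𝔭 ↦ by have h := 𝔭.2; rw [finrank_traceDual_quotient_eq_one_of_quadratic μ hT (asIdeal_ne_bot μ 𝔭.1)] at h; omega⟩
  rw [Nat.card_of_isEmpty, pow_zero]

/-- **COROLLARY 3.6 in degree `2`: at a singular (non-invertible) prime of a quadratic order, `dim_{S/𝔭} (𝔭:𝔭)/𝔭 = 2`**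
(`= type_𝔭 + 1`). [cite: Marseglia2024CMType, §3 Prop. 3.5, Cor. 3.6, p. 9] -/
theorem finrank_div_self_quotient_eq_two_of_quadratic {T : FractionalIdeal (endOrder (Algebra.leftMulMatrix μ))⁰ K}
    (hT : (T : Submodule (endOrder (Algebra.leftMulMatrix μ)) K) =
      traceDual ℤ ℚ ((1 : FractionalIdeal (endOrder (Algebra.leftMulMatrix μ))⁰ K) :
        Submodule (endOrder (Algebra.leftMulMatrix μ)) K))
    {𝔭 : Ideal (endOrder (Algebra.leftMulMatrix μ))} [h𝔭 : 𝔭.IsPrime] (h0 : 𝔭 ≠ ⊥)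
    (hu : ¬ IsUnit (𝔭 : FractionalIdeal (endOrder (Algebra.leftMulMatrix μ))⁰ K)) :
    Module.finrank (endOrder (Algebra.leftMulMatrix μ) ⧸ 𝔭)
      ((((𝔭 : FractionalIdeal (endOrder (Algebra.leftMulMatrix μ))⁰ K) / 𝔭 :
        FractionalIdeal (endOrder (Algebra.leftMulMatrix μ))⁰ K) : Submodule (endOrder (Algebra.leftMulMatrix μ)) K) ⧸
        (𝔭 • ⊤ : Submodule (endOrder (Algebra.leftMulMatrix μ))
          (((𝔭 : FractionalIdeal (endOrder (Algebra.leftMulMatrix μ))⁰ K) / 𝔭 :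
            FractionalIdeal (endOrder (Algebra.leftMulMatrix μ))⁰ K) : Submodule (endOrder (Algebra.leftMulMatrix μ)) K))) =
      2 := by
  rw [(finrank_div_self_quotient_eq_finrank_traceDual_quotient_add_one_iff μ hT h0).2 hu,
    finrank_traceDual_quotient_eq_one_of_quadratic μ hT h0]

/-- **Equation (4.3) in degree `2`: `gens_S((𝔭:𝔭)) = 2` at a singular prime of a quadratic order** (the over-order
`(𝔭:𝔭) ⊋ S` is generated by two elements but is not principal). [cite: Marseglia2024CMType, §4 Thm. 4.7 (proof, eq. (4.3)),
p. 11] -/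
theorem spanFinrank_coe_div_self_eq_two_of_quadratic {T : FractionalIdeal (endOrder (Algebra.leftMulMatrix μ))⁰ K}
    (hT : (T : Submodule (endOrder (Algebra.leftMulMatrix μ)) K) =
      traceDual ℤ ℚ ((1 : FractionalIdeal (endOrder (Algebra.leftMulMatrix μ))⁰ K) :
        Submodule (endOrder (Algebra.leftMulMatrix μ)) K))
    (𝔭 : Ideal (endOrder (Algebra.leftMulMatrix μ))) [h𝔭 : 𝔭.IsMaximal]
    (hu : ¬ IsUnit (𝔭 : FractionalIdeal (endOrder (Algebra.leftMulMatrix μ))⁰ K)) :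
    ((((𝔭 : FractionalIdeal (endOrder (Algebra.leftMulMatrix μ))⁰ K) / 𝔭 :
        FractionalIdeal (endOrder (Algebra.leftMulMatrix μ))⁰ K) : Submodule (endOrder (Algebra.leftMulMatrix μ)) K)).spanFinrank =
      2 := by
  rw [spanFinrank_coe_div_self_eq_finrank_traceDual_quotient_add_one μ hT 𝔭 hu,
    finrank_traceDual_quotient_eq_one_of_quadratic μ hT (ne_bot_of_isMaximal μ h𝔭)]

/-- **PROPOSITION 4.5 in degree `2`: `dim_{S/𝔭} 𝒪_K/𝔭𝒪_K = 2` at a singular prime of a quadratic order** (the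
over-order `S + 𝔭𝒪_K` is again a quadratic order, of type `1`). [cite: Marseglia2024CMType, §4 Prop. 4.5, p. 10] -/
theorem finrank_quotient_smul_top_eq_two_of_quadratic {M : FractionalIdeal (endOrder (Algebra.leftMulMatrix μ))⁰ K}
    (hMO : (M : Set K) = (algebraMap (𝓞 K) K).range) {𝔭 : Ideal (endOrder (Algebra.leftMulMatrix μ))}
    [h𝔭 : 𝔭.IsMaximal] (hu : ¬ IsUnit (𝔭 : FractionalIdeal (endOrder (Algebra.leftMulMatrix μ))⁰ K)) :
    Module.finrank (endOrder (Algebra.leftMulMatrix μ) ⧸ 𝔭)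
      (↥(M : Submodule (endOrder (Algebra.leftMulMatrix μ)) K) ⧸
        (𝔭 • ⊤ : Submodule (endOrder (Algebra.leftMulMatrix μ)) (M : Submodule (endOrder (Algebra.leftMulMatrix μ)) K))) =
      2 := by
  obtain ⟨ν, hν, -, h⟩ := exists_basis_finrank_quotient_smul_top_eq_iSup_add_one μ hMO hu
  haveI := isFractionRing_endOrder (Algebra.leftMulMatrix ν)
  obtain ⟨T', -, hT'⟩ := exists_coe_eq_traceDual ν (one_ne_zero' (FractionalIdeal (endOrder (Algebra.leftMulMatrix ν))⁰ K))
  rw [h T' hT', iSup_finrank_traceDual_quotient_eq_one_of_quadratic ν hT']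

/-- **COROLLARY 4.4 in degree `2`: `gens_S(𝒪_K) = 2` for every non-maximal quadratic order** (`𝒪_K = S + Sω` needs two
generators and is not principal over `S`). [cite: Marseglia2024CMType, §4 Cor. 4.4, p. 10] -/
theorem spanFinrank_coe_eq_two_of_quadratic {M : FractionalIdeal (endOrder (Algebra.leftMulMatrix μ))⁰ K}
    (hMO : (M : Set K) = (algebraMap (𝓞 K) K).range)
    (hS : ∃ a : 𝓞 K, (a : K) ∉ endOrder (Algebra.leftMulMatrix μ)) :
    (M : Submodule (endOrder (Algebra.leftMulMatrix μ)) K).spanFinrank = 2 := by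
  obtain ⟨𝔭, hu, -⟩ := exists_not_isUnit_forall_iSup_add_one_eq_spanFinrank_coe μ hMO hS
  obtain ⟨𝔭₁, h𝔭₁⟩ := exists_finrank_quotient_smul_top_eq_iSup μ hMO
  rw [spanFinrank_coe_eq_iSup_finrank_quotient_smul_top μ hMO hS, ← h𝔭₁]
  -- every dimension is `1` (regular primes) or `2` (singular primes); the maximum is attained at a singular one
  by_cases hu₁ : IsUnit (𝔭₁.asIdeal : FractionalIdeal (endOrder (Algebra.leftMulMatrix μ))⁰ K)
  · exfalso
    have h1 := (EndOrder.finrank_quotient_eq_one_iff_isUnit_coeIdeal hMO (asIdeal_ne_bot μ 𝔭₁)).2 hu₁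
    have h2 := (finrank_quotient_smul_top_two_le_of_not_isUnit μ hMO (asIdeal_ne_bot μ 𝔭) hu).trans
      (le_ciSup (bddAbove_range_finrank_quotient_smul_top μ hMO) 𝔭)
    rw [← h𝔭₁] at h2
    omega
  · exact finrank_quotient_smul_top_eq_two_of_quadratic μ hMO hu₁

/-- **Quadratic orders are Bass: `𝒪_K = S + Sω` for some `ω`, for every order `S = endOrder (M_μ)` of a quadratic
field** (`dim_{S/𝔭} 𝒪_K/𝔭𝒪_K = 2` at every singular prime, PROP. 4.5 in degree `2`, and
`CMOrderBassCharacterization`'s GREITHER PROP. 1.1 criterion); hence all of PROP. 4.6 (i)–(v) for quadratic orders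
(`CMOrderBassCyclicQuotient*`). [cite: Marseglia2024CMType, §4 Prop. 4.6 and Prop. 4.5, p. 10; §1 («the case when
`S` is a non-maximal Bass order»), p. 3] [cite: Greither1982TwoGenerator, §1 Prop. 1.1, p. 266] -/
theorem exists_coe_eq_span_pair_of_quadratic {M : FractionalIdeal (endOrder (Algebra.leftMulMatrix μ))⁰ K}
    (hMO : (M : Set K) = (algebraMap (𝓞 K) K).range) :
    ∃ ω ∈ M, (M : Submodule (endOrder (Algebra.leftMulMatrix μ)) K) =
      Submodule.span (endOrder (Algebra.leftMulMatrix μ)) {1, ω} :=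
  (exists_coe_eq_span_pair_iff_forall_not_isUnit_finrank_quotient_eq_two μ hMO).2 fun 𝔭 hu ↦ by
    haveI := 𝔭.isMaximal
    exact finrank_quotient_smul_top_eq_two_of_quadratic μ hMO hu

end Quadratic

/-! ## §2 Validation on `S = ℤ[√-3] = ℤ[2ζ₃]` and its singular prime `𝔭₂ = (2, 1+√-3) = 𝔣_S` -/

namespace EisensteinTwo

-- Mathlib's extra `ℤ`-algebra structure `CyclotomicField.instAlgebra` on `K₃ = CyclotomicField 3 ℚ` is not reducibly
-- `Ring.toIntAlgebra`, so a hypothesis `↑T = traceDual ℤ ℚ ↑1` written ON `K₃` does not elaborate (`IsScalarTower ℤ ℚ K₃`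
-- is not found); instead of switching the instance off, the trace dual `Sᵗ` is described below through the trace
-- pairing (`∀ y ∈ S, Tr(xy) ∈ ℤ`) and converted by the generic §1 lemma `coe_eq_traceDual_one_of_forall_mem_iff`.

/-- `ℤ[√-3] ≠ 𝒪_K = ℤ[ζ₃]` in the series' form «some algebraic integer is not in `S`» (`𝔣_S = 𝔭₂ ≠ S`).
[cite: Stevenhagen2008NumberRings, §6 («For `R = ℤ[√-3]` […] `𝔣_R = 2𝒪`»), p. 224] -/
theorem exists_coe_not_mem_endOrder_basis : ∃ a : 𝓞 K₃, (a : K₃) ∉ endOrder (Algebra.leftMulMatrix basis) := by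
  by_contra hall
  push Not at hall
  have htop := (EndOrder.conductorIdeal_eq_top_iff (ρ := Algebra.leftMulMatrix basis)).2 hall
  rw [conductorIdeal_basis_eq_primeTwo] at htop
  exact isMaximal_primeTwo.ne_top htop

/-- **`type_{𝔭₂}(ℤ[√-3]) = 1`** (a quadratic order; equivalently PROP. 4.9's `[K:ℚ] − 1 = 1` is attained at the singular
prime of `ℤ + 2𝒪_K = ℤ[√-3]`). [cite: Marseglia2024CMType, §3 Prop. 3.4, p. 9; §4 Prop. 4.9, p. 11]
[cite: Stevenhagen2008NumberRings, Examples 4.2, p. 217] -/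
theorem finrank_traceDual_quotient_primeTwo_eq_one {T : FractionalIdeal (endOrder (Algebra.leftMulMatrix basis))⁰ K₃}
    (hT : ∀ x : K₃, x ∈ T ↔ ∀ y ∈ endOrder (Algebra.leftMulMatrix basis), ∃ n : ℤ, Algebra.trace ℚ K₃ (x * y) = n) :
    Module.finrank (endOrder (Algebra.leftMulMatrix basis) ⧸ primeTwo)
      ((T : Submodule (endOrder (Algebra.leftMulMatrix basis)) K₃) ⧸
        (primeTwo • ⊤ : Submodule (endOrder (Algebra.leftMulMatrix basis))
          (T : Submodule (endOrder (Algebra.leftMulMatrix basis)) K₃))) = 1 :=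
  haveI := isPrime_primeTwo
  finrank_traceDual_quotient_eq_one_of_quadratic basis (coe_eq_traceDual_one_of_forall_mem_iff basis hT) primeTwo_ne_bot

/-- **`type(ℤ[√-3]) = 1`.** [cite: Marseglia2024CMType, §3 Def. 3.2 (ii), Prop. 3.4, p. 9] -/
theorem iSup_finrank_traceDual_quotient_basis_eq_one {T : FractionalIdeal (endOrder (Algebra.leftMulMatrix basis))⁰ K₃}
    (hT : ∀ x : K₃, x ∈ T ↔ ∀ y ∈ endOrder (Algebra.leftMulMatrix basis), ∃ n : ℤ, Algebra.trace ℚ K₃ (x * y) = n) :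
    ⨆ 𝔭 : MaximalSpectrum (endOrder (Algebra.leftMulMatrix basis)),
        Module.finrank (endOrder (Algebra.leftMulMatrix basis) ⧸ 𝔭.asIdeal)
          ((T : Submodule (endOrder (Algebra.leftMulMatrix basis)) K₃) ⧸
            (𝔭.asIdeal • ⊤ : Submodule (endOrder (Algebra.leftMulMatrix basis))
              (T : Submodule (endOrder (Algebra.leftMulMatrix basis)) K₃))) = 1 :=
  iSup_finrank_traceDual_quotient_eq_one_of_quadratic basis (coe_eq_traceDual_one_of_forall_mem_iff basis hT)

/-- **`dim_{𝔽₂} (𝔭₂:𝔭₂)/𝔭₂ = 2`** (`(𝔭₂:𝔭₂) = ℤ[ζ₃]` and `ℤ[ζ₃]/2ℤ[ζ₃] = 𝔽₄`; COR. 3.6: `= type_{𝔭₂} + 1`).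
[cite: Marseglia2024CMType, §3 Prop. 3.5, Cor. 3.6, p. 9] [cite: Stevenhagen2008NumberRings, Examples 4.2 («multiplier ring
`ℤ[α]`»), p. 217] -/
theorem finrank_primeTwo_div_self_quotient_eq_two :
    Module.finrank (endOrder (Algebra.leftMulMatrix basis) ⧸ primeTwo)
      ((((primeTwo : FractionalIdeal (endOrder (Algebra.leftMulMatrix basis))⁰ K₃) / primeTwo :
        FractionalIdeal (endOrder (Algebra.leftMulMatrix basis))⁰ K₃) :
          Submodule (endOrder (Algebra.leftMulMatrix basis)) K₃) ⧸
        (primeTwo • ⊤ : Submodule (endOrder (Algebra.leftMulMatrix basis))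
          (((primeTwo : FractionalIdeal (endOrder (Algebra.leftMulMatrix basis))⁰ K₃) / primeTwo :
            FractionalIdeal (endOrder (Algebra.leftMulMatrix basis))⁰ K₃) :
              Submodule (endOrder (Algebra.leftMulMatrix basis)) K₃))) = 2 := by
  haveI := isPrime_primeTwo
  obtain ⟨T, -, hT⟩ := exists_coe_eq_traceDual basis
    (one_ne_zero' (FractionalIdeal (endOrder (Algebra.leftMulMatrix basis))⁰ K₃))
  exact finrank_div_self_quotient_eq_two_of_quadratic basis hT primeTwo_ne_bot not_isUnit_primeTwo

/-- **`gens_{ℤ[√-3]}((𝔭₂:𝔭₂)) = 2`** (`(𝔭₂:𝔭₂) = ℤ[ζ₃] = ℤ[√-3]·1 + ℤ[√-3]·ζ₃` is not principal over `ℤ[√-3]`).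
[cite: Marseglia2024CMType, §4 Thm. 4.7 (proof, eq. (4.3)), p. 11] -/
theorem spanFinrank_coe_primeTwo_div_self_eq_two :
    ((((primeTwo : FractionalIdeal (endOrder (Algebra.leftMulMatrix basis))⁰ K₃) / primeTwo :
        FractionalIdeal (endOrder (Algebra.leftMulMatrix basis))⁰ K₃) :
          Submodule (endOrder (Algebra.leftMulMatrix basis)) K₃)).spanFinrank = 2 := by
  haveI := isMaximal_primeTwo
  obtain ⟨T, -, hT⟩ := exists_coe_eq_traceDual basis
    (one_ne_zero' (FractionalIdeal (endOrder (Algebra.leftMulMatrix basis))⁰ K₃))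
  exact spanFinrank_coe_div_self_eq_two_of_quadratic basis hT primeTwo not_isUnit_primeTwo

/-- **`dim_{𝔽₂} 𝒪_K/𝔭₂𝒪_K = 2`** (`𝔭₂𝒪_K = 2𝒪_K`, `𝒪_K/2𝒪_K = 𝔽₄`; PROP. 4.5: `= 1 + type(ℤ[√-3] + 𝔭₂𝒪_K)`).
[cite: Marseglia2024CMType, §4 Prop. 4.5, p. 10] [cite: Stevenhagen2008NumberRings, §6 («`𝔣_R = 2𝒪`»), p. 224] -/
theorem finrank_maximalOrder_quotient_primeTwo_eq_two {M : FractionalIdeal (endOrder (Algebra.leftMulMatrix basis))⁰ K₃}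
    (hMO : (M : Set K₃) = (algebraMap (𝓞 K₃) K₃).range) :
    Module.finrank (endOrder (Algebra.leftMulMatrix basis) ⧸ primeTwo)
      (↥(M : Submodule (endOrder (Algebra.leftMulMatrix basis)) K₃) ⧸
        (primeTwo • ⊤ : Submodule (endOrder (Algebra.leftMulMatrix basis))
          (M : Submodule (endOrder (Algebra.leftMulMatrix basis)) K₃))) = 2 :=
  haveI := isMaximal_primeTwo
  finrank_quotient_smul_top_eq_two_of_quadratic basis hMO not_isUnit_primeTwo

/-- **`gens_{ℤ[√-3]}(𝒪_K) = 2`** (`𝒪_K = ℤ[ζ₃] = ℤ[√-3] + ℤ[√-3]ζ₃`, COR. 4.4 in degree `2`).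
[cite: Marseglia2024CMType, §4 Cor. 4.4, p. 10] -/
theorem spanFinrank_coe_maximalOrder_eq_two {M : FractionalIdeal (endOrder (Algebra.leftMulMatrix basis))⁰ K₃}
    (hMO : (M : Set K₃) = (algebraMap (𝓞 K₃) K₃).range) :
    (M : Submodule (endOrder (Algebra.leftMulMatrix basis)) K₃).spanFinrank = 2 :=
  spanFinrank_coe_eq_two_of_quadratic basis hMO exists_coe_not_mem_endOrder_basis

end EisensteinTwo

end CMTypeLattice

end Literature.NumberTheory.ComplexMultiplication
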